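import Summits.ResolutionOfSingularities.ResolutionOfSingularities.Theorems.HeronCutLaw
import HarnessLib

/-!
# HeronCutLaw2 — decomp-res node «HeronCut» (lens-5 g32, critic row 201 CLEARED (T-3) +1), tree file 2/3 of the node

Content VERBATIM from the decomp-res lens-5 g32 node «HeronCut», landing shape (A′)
`HOME/decomp-res-lens-5/g32/landing/HeronCutLaw.lean` (ea49c374) / (B′) `landing/HeronCutStar.lean` (0944ef8c) (shas
= PIN STATUS 08:54:16Z; carry replaced by the landed `ThreadCutLaw*` / `ThreadCutPinf`); HOME =
run/shared/lean/pub/decomp-res; critic CRITIC-LEDGER row 201 CLEARED (T-3) +1; landing orders INBOX :1252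
(08:57:52Z) — provenance and critic text in full in the first file of the node, `HeronCutLaw`; the (A′) landing
header verbatim in `HeronCutLaw2`.  `--kind proof --supports stmt-ResolutionOfSingularities-31770`.

The lens header, verbatim (carried in this file of the node):

> # HeronCut — THE HERON POTENTIAL: every corner thread of the E-model is eventually heavy, with an explicit
> light-step budget (decomp-res ROOT DECOMPOSITION CELL, residual mode; lens-5 «finite/base range + asymptotic regime +
> bridge», generation 32; critic row 198 WINDOW item (T-3) «ALL CORNER THREADS decided in walk currency»).
>
> THE KIND (stated in advance, row 198): CORNER THREADS of `ThreadCut.Thread q s₀` — from some time on every point blown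
> up is the chart ORIGIN (`b = 0`, `Thread.CornerTailFrom`) — with ANY chart word (one, two or THREE recurring charts;
> g31 «ThreadCut» decided ≤ 2 charts by the `SL₂` product potential, three recurring charts were tagged IDEA-NEEDED).
>
> TREE AUDIT (honest; corrects g31's «open for forced walks too»).  For FORCED WALKS FROM ROOTS the tree already decides
> origin tails for every word: lens-3 g12 `CornerTowerDynamics.dyn3_eventually` (pure `ℤ³` dynamics, `ℓ¹` Lyapunov with
> two phases; hypotheses «never triply negative» and «EVERY LETTER RECURS») feeding `ProximityCut.no_origin_tail_rec` and
> the piece `ProximityCut.NoOriginTails` (`noOriginTails_holds`; binders `p` prime, `q = pᵉ`, `CharP`, `PerfectField`,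
> `IsRoot`, the isolation endgame `false_of_fat`).  Hypothesis-free the tree has only `LassoCut.corner_tail_uses_all_charts`.
>
> THE NEW LEVER (§1).  The HERON POTENTIAL of a defect vector `ρ : L → ℤ` (for a monomial `m` at exponent `q`:
> `ρ_k = off_k(m) − q`, `off_k = |m| − m_k`) over a finite set of letters `L`, `|L| = n`:
>   `Ψ(ρ) := (Σ_k ρ_k)² − (n−1)·Σ_k ρ_k²`   (`n = 3`: `Ψ = 2e₂(ρ) − Σρ² = 16·Area²` of the triangle with sides `√ρ_k`,
>   HERON's formula; a Lorentz form of signature `(1,2)` with time axis `(1,1,1)`; `n = 2`: `Ψ = 2ρ_Jρ_K` = twice the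
>   `SL₂` product potential `π` of `CornerTowerDescent.two_letter_descent` / `ThreadCut.two_letter_eventually_heavy`).
> * (H1) `heron_transvection`: a corner blow-up in chart `j` acts on defect vectors by the transvection `ρ_k ↦ ρ_k + ρ_j`
>   (`k ≠ j`), `ρ_j ↦ ρ_j`, and `Ψ(T_jρ) = Ψ(ρ) + 2(n−1)ρ_j²`: MONOTONE UNDER EVERY STEP, strictly up at every non-neutral
>   step, in particular at every LIGHT step (`ρ_j < 0`) — for every number of letters, with no recurrence hypothesis.
> * (H2) `heron_nonpos_of_mixed`: a vector with a negative AND a non-negative coordinate has `Ψ ≤ 0` (Cauchy–Schwarz on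
>   `n − 1` coordinates).  Triply (all-)negative vectors lose degree at every step (absurd on an infinite thread); the
>   non-negative orthant is absorbing (heavy forever).
> ⇒ (§2) ABSTRACT ALL-LETTER ENGINE `all_letter_eventually_heavy` (the signature of `two_letter_eventually_heavy` with the
> two-letter hypothesis DELETED) and its QUANTITATIVE form `light_steps_le_budget`: the number of light steps of the whole
> support is at most the LIGHT BUDGET `Σ_{a ∈ S₀} charge(a)`, `charge(a) = 1 − Ψ(ρ(a))` for elements with a light letter.
>
> THE LAW (§3, KERNEL, hypothesis-free: every `q`, every field, every chart word, no root / characteristic / perfectness /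
> isolation / recurrence binder).  `Thread.eventually_offHeavy_of_cornerTail`: a corner thread is EVENTUALLY HEAVY AT
> EVERY STEP (the played axis is a top line through the thread point); `Thread.cornerTail_light_steps_le`: the number of
> light (non-axial) corner blow-ups after time `T₀` is AT MOST the Heron budget of the stage `T₀ + 1` — a FINITE LIGHT
> RANGE computed from the Newton support, then the ASYMPTOTIC STAR REGIME: `Thread.eventually_offHeavy_of_recurs` (heavy for
> every chart that recurs, from some time on, at every stage), `Thread.eventually_offHeavy_all` (three recurring charts ⇒ all
> three axes are top lines, `topIdeal_le_tripod`).  EMPTY CELL `Thread.no_light_io_cornerTail`.  FORCED WALKS (§4):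
> `ForcedWalk.no_cornerTail` — NO forced walk has a corner tail, for any word (hyp-free) — so EVERY FORCED WALK TRANSLATES
> INFINITELY OFTEN (`ForcedWalk.translating`); RECOVERY as one-liners: `ProximityCut.NoOriginTails` (`noOriginTails_of_heron`,
> all its binders now idle) and `LassoCut.corner_tail_uses_all_charts`.
>
> EXACTNESS (§5).  A TRISTAR stage (all monomials of degree `≥ q`, heavy for all three charts; `Tristar q F ↔ ∀ J K,
> ThreadCut.Cruciform q J K F`) carries the infinite corner thread of EVERY word `ω : ℕ → Fin 3` (`Thread.ofTristar`), tristar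
> and non-isolated at every stage, and NO forced walk (§6: certified ROOTS `⟨(X_s·X_u·X_w)^a, 0⟩`, `q ≤ 2a`, `q ∤ a` —
> `star_isRoot`, `starThread ω` for all `3^ℕ` words, e.g. `z³ + s²u²w²` with the cyclic word `s u w …` recurring in every
> chart, `star32_cyclic_recurs`).  With g31's `Thread.ofCruciform` (two charts) and the law: corner threads exist
> EXACTLY over stages that are (eventually) heavy for the set of charts they keep playing — the kind «corner threads» is
> DECIDED IFF-WISE for every chart set.  LOCATED RESIDUAL of the thread axis after this node (model): TRANSLATING threads
> (`b ≠ 0` infinitely often) ONLY.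
>
> DESK (0-priced, posted first; `HOME/decomp-res-lens-5/g32/desk/heron_desk.py`): (H1)/(H2) on 6·10⁵ random vectors and for
> `Ψ_n`, `n = 2,4,5`; exhaustive game tree over all corner words from 2 697 viable mixed monomial stages (`q ≤ 9`): light
> steps `≤ ⌊−Ψ₀/4⌋ + 1`, 0 violations; the period-3 word `(s u w)^ω` on 987 roots: no perpetual light; the star root carries
> random words.  LANDING SHAPE (A′) of the node
> `HOME/decomp-res-lens-5/g32/HeronCut.lean` (§1–§4; §5–§7 = `HeronCutStar.lean`): imports the rider-198 files `ThreadCutLaw` /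
> `ThreadCutPinf` instead of the node's CARRY block.  0 `sorry`.  (Sources: Hauser2010 §§F–G; CornerTowerDescent
(lens-5 g13); CornerTowerDynamicsThree + ProximityCutOrigin
> (lens-3 g12); ThreadCut (lens-5 g31).)

## This file

§3 THE THREAD LAW FOR ALL CORNER TAILS (`namespace …ThreadCut`, continued; `section AllCharts`; three charts, ANY
word, hypothesis-free): the transport of the engine to `Thread q s₀` (defect vectors of the Newton support,
`heronBudget`), **`Thread.cornerTail_light_steps_le`** (quantitative),
**`Thread.eventually_offHeavy_of_cornerTail`** (THE LAW), the EMPTY cell `Thread.no_light_io_cornerTail`, the star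
regime `Thread.eventually_offHeavy_of_recurs` / `Thread.eventually_offHeavy_all` (`topIdeal_le_tripod`), the bridge
shadows `Thread.eventually_not_isolated_of_cornerTail` / `Thread.translating_of_isolated_io`; §4 FORCED WALKS
(`section Walks`): **`ForcedWalk.no_cornerTail`**, **`ForcedWalk.translating`**, and the recoveries
`noOriginTails_of_heron` (lens-3 g12's `ProximityCut.NoOriginTails`, all binders idle) / `corner_tail_uses_all_charts'`.

[WRITER NOTE (decomp-res writer g13): file split only — (A′) is 547 lines, over the tree's 400-line cap, and is cut
at the node's own root-namespace boundary: `HeronCutLaw` = `namespace …Theorems.HeronCut` (§1–§2), `HeronCutLaw2` =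
`namespace …Theorems.ThreadCut` (§3–§4); (B′) `HeronCutStar` is one file; sections, section variables, `open … in`
combinators and every declaration exactly as in the landing files; the file-level `open` lines are replayed in each
part.  TWO writer token fixes, both forced: (i) the landing files' import lines spell the module prefix `Summit.…`
(a typo — the tree's modules are `Summits.…`, as in the node file itself) → `Summits.…`; (ii) `ThreadCutLaw` was cut
by the cap into `ThreadCutLaw` + `ThreadCutLaw2` at its landing (g12), so (A′) imports `ThreadCutLaw2` (⊇
`ThreadCutLaw`) to have the whole of g31 §1–§4 in scope, and (B′) imports `HeronCutLaw2` (⊇ `HeronCutLaw`).]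

(Sources: Hauser2010 §§F–G (kangaroo points, corner/translation moves); CossartJannsenSaito2020 Ch. 8;
HauserPerlega2019 §2; Hironaka1964 Ch. III.)
-/

open MvPolynomial
open Literature.AlgebraicGeometry.Resolution
open Literature.AlgebraicGeometry.Resolution.Hauser2010
open Literature.AlgebraicGeometry.Resolution.PointBlowup
open Summit.ResolutionOfSingularities.ResolutionOfSingularities.Theorems.TightDefectClasses
open Summit.ResolutionOfSingularities.ResolutionOfSingularities.Theorems.CornerTowerDescent
open Summit.ResolutionOfSingularities.ResolutionOfSingularities.Theorems.LassoCut

/-! # HeronCut — §3–§6: the THREE-CHART THREAD LAW, the forced-walk corollaries, tristar existence (namespace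
`ThreadCut`, lens-5's own, continued) -/

namespace Summit.ResolutionOfSingularities.ResolutionOfSingularities.Theorems.ThreadCut

open Summit.ResolutionOfSingularities.ResolutionOfSingularities.Theorems.HeronCut

section AllCharts

variable {K : Type} [Field K] [DecidableEq K] {q : ℕ} {s₀ : State (Fin 3) K}

/-! ## §3 THE THREAD LAW FOR ALL CORNER TAILS (three charts, any word) -/

/-- the HERON LIGHT BUDGET of a stage: `Σ_{m light} (1 − Ψ(off(m) − q))` over its support. DEFINITION (support). -/
noncomputable def heronBudget (q : ℕ) (F : MvPolynomial (Fin 3) K) : ℕ :=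
  budget q (fun (k : Fin 3) (m : Fin 3 →₀ ℕ) => m.degree - m k) F.support

/-- **THREAD CORNER LAW, ALL CHARTS — QUANTITATIVE** (KERNEL, every `q`, every field, EVERY chart word): along a corner
tail from `T₀` (all points `b = 0`, charts arbitrary) the set of LIGHT steps `t ≥ T₀` (the stage `t+1` is not off-heavy
for the chart played there) has cardinality at most the HERON LIGHT BUDGET of the stage `T₀ + 1`.
[DECIDED — PROVED here, by `light_steps_le_budget`] (Sources: Hauser2010, §F; the potential is new.) -/
theorem Thread.cornerTail_light_steps_le (T : Thread q s₀) (T₀ : ℕ) (hc : T.CornerTailFrom T₀) (U : Finset ℕ)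
    (hU : ∀ t ∈ U, T₀ ≤ t ∧ ¬ OffHeavy q (T.j (t + 1)) (T.st (t + 1)).F) :
    U.card ≤ heronBudget q (T.st (T₀ + 1)).F := by
  classical
  have hB := light_steps_le_budget (A := Fin 3 →₀ ℕ) (L := Fin 3) q (fun m => m.degree)
    (fun k m => m.degree - m k) (fun i => (T.st (T₀ + i + 1)).F.support) (fun i => chartExponent q (T.j (T₀ + i + 1)))
    (fun i => T.j (T₀ + i + 1)) (fun i m => offDegree_chartExponent q _ m)
    (fun i m k hk hq => offDegree_chartExponent_of_ne q hk m hq)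
    (fun i m hq => by
      rw [degree_chartExponent]
      have h2 : m (T.j (T₀ + i + 1)) ≤ m.degree := by
        rw [degree_eq_add_sum_erase (T.j (T₀ + i + 1)) m]; exact Nat.le_add_right _ _
      omega)
    (fun i => T.support_succ_subset_image (T₀ + i) (hc (T₀ + i) (Nat.le_add_right _ _)))
    (fun i m hm hlow => (T.low_monomial_transport rfl (hc (T₀ + i) (Nat.le_add_right _ _)) hm hlow).1)
    (fun i m hm => T.le_degree_of_mem_support_succ (T₀ + i) hm)
    (U.image fun t => t - T₀)
    (fun i hi => by
      obtain ⟨t, ht, rfl⟩ := Finset.mem_image.mp hi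
      obtain ⟨hT₀, hl⟩ := hU t ht
      unfold OffHeavy at hl
      push Not at hl
      obtain ⟨m, hm, hlt⟩ := hl
      have e : T₀ + (t - T₀) + 1 = t + 1 := by omega
      refine ⟨m, ?_, ?_⟩
      · rw [e]; exact hm
      · rw [e]; exact hlt)
  have hinj : Set.InjOn (fun t => t - T₀) ↑U := by
    intro t₁ h₁ t₂ h₂ h
    have := (hU t₁ h₁).1
    have := (hU t₂ h₂).1
    simp only at h
    omega
  rw [Finset.card_image_of_injOn hinj] at hB
  simpa [heronBudget] using hB

/-- **THREAD CORNER LAW, ALL CHARTS** (KERNEL, every `q`, every field, EVERY chart word): a thread through CORNER points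
only from time `T₀` on is EVENTUALLY AXIAL for the played chart — from some time on every stage is off-heavy for the
chart played there (the played axis is a top line through the thread point).  No hypothesis on the word: g31's
two-chart law and the tree's forced-walk cell `ProximityCut.noOriginTails_holds` (roots, `CharP`, perfect field,
isolation) are both special cases.  [DECIDED — PROVED here, by `all_letter_eventually_heavy`] (Sources: Hauser2010, §F.) -/
theorem Thread.eventually_offHeavy_of_cornerTail (T : Thread q s₀) (T₀ : ℕ) (hc : T.CornerTailFrom T₀) :
    ∃ N, ∀ t, N ≤ t → OffHeavy q (T.j (t + 1)) (T.st (t + 1)).F := by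
  classical
  have H : ∃ N, ∀ i, N ≤ i → ∀ a ∈ (T.st (T₀ + i + 1)).F.support, q ≤ a.degree - a (T.j (T₀ + i + 1)) :=
    all_letter_eventually_heavy (A := Fin 3 →₀ ℕ) (L := Fin 3) q (fun m => m.degree)
      (fun k m => m.degree - m k) (fun i => (T.st (T₀ + i + 1)).F.support) (fun i => chartExponent q (T.j (T₀ + i + 1)))
      (fun i => T.j (T₀ + i + 1)) (fun i m => offDegree_chartExponent q _ m)
      (fun i m k hk hq => offDegree_chartExponent_of_ne q hk m hq)
      (fun i m hq => by
        rw [degree_chartExponent]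
        have h2 : m (T.j (T₀ + i + 1)) ≤ m.degree := by
          rw [degree_eq_add_sum_erase (T.j (T₀ + i + 1)) m]; exact Nat.le_add_right _ _
        omega)
      (fun i => T.support_succ_subset_image (T₀ + i) (hc (T₀ + i) (Nat.le_add_right _ _)))
      (fun i m hm hlow => (T.low_monomial_transport rfl (hc (T₀ + i) (Nat.le_add_right _ _)) hm hlow).1)
      (fun i m hm => T.le_degree_of_mem_support_succ (T₀ + i) hm)
  obtain ⟨N, hN⟩ := H
  refine ⟨T₀ + N, fun t ht m hm => ?_⟩
  obtain ⟨i, rfl⟩ : ∃ i, t = T₀ + i := ⟨t - T₀, by omega⟩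
  exact hN i (by omega) m hm

/-- THE EMPTY CELL: NO corner thread — three charts, any word — has infinitely many LIGHT steps; in particular there is
NO «perpetual-light 3-chart corner thread» (the iff-classification's other inhabitant does not exist).
[DECIDED — PROVED here] (Sources: Hauser2010, §F.) -/
theorem Thread.no_light_io_cornerTail (T : Thread q s₀) (T₀ : ℕ) (hc : T.CornerTailFrom T₀)
    (hlight : ∀ N, ∃ t, N ≤ t ∧ ¬ OffHeavy q (T.j (t + 1)) (T.st (t + 1)).F) : False := by
  obtain ⟨N, hN⟩ := T.eventually_offHeavy_of_cornerTail T₀ hc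
  obtain ⟨t, ht, hl⟩ := hlight N
  exact hl (hN t ht)

/-- … once axial for a chart `u_k` at a late stage of a corner tail, axial for `u_k` forever. [folklore] -/
theorem Thread.cornerTail_offHeavy_from (T : Thread q s₀) (T₀ N : ℕ) (hc : T.CornerTailFrom T₀)
    (hN : ∀ t, N ≤ t → OffHeavy q (T.j (t + 1)) (T.st (t + 1)).F) {k : Fin 3} {t₁ : ℕ} (ht₁ : max T₀ N ≤ t₁)
    (hk : OffHeavy q k (T.st (t₁ + 1)).F) : ∀ t, t₁ ≤ t → OffHeavy q k (T.st (t + 1)).F := by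
  intro t ht
  induction t, ht using Nat.le_induction with
  | base => exact hk
  | succ t ht ih => exact T.offHeavy_succ t (hc t (by omega)) (hN t (by omega)) ih

/-- … hence EVENTUALLY AXIAL FOR EVERY RECURRING CHART. [DECIDED — PROVED here] (Sources: Hauser2010, §F.) -/
theorem Thread.eventually_offHeavy_of_recurs (T : Thread q s₀) (T₀ : ℕ) (hc : T.CornerTailFrom T₀) (k : Fin 3)
    (hk : ∀ N, ∃ t, N ≤ t ∧ T.j (t + 1) = k) : ∃ N, ∀ t, N ≤ t → OffHeavy q k (T.st (t + 1)).F := by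
  obtain ⟨N, hN⟩ := T.eventually_offHeavy_of_cornerTail T₀ hc
  obtain ⟨t₁, ht₁, hj₁⟩ := hk (max T₀ N)
  have h1 : OffHeavy q k (T.st (t₁ + 1)).F := by rw [← hj₁]; exact hN t₁ (le_trans (le_max_right _ _) ht₁)
  exact ⟨t₁, T.cornerTail_offHeavy_from T₀ N hc hN ht₁ h1⟩

/-- **TRISTAR LAW**: if ALL THREE charts recur along a corner tail, the thread is EVENTUALLY TRISTAR — axial for every
chart, the thread point is the triple point of the three top axes. [DECIDED — PROVED here] (Sources: Hauser2010, §F.) -/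
theorem Thread.eventually_offHeavy_all (T : Thread q s₀) (T₀ : ℕ) (hc : T.CornerTailFrom T₀)
    (hall : ∀ k : Fin 3, ∀ N, ∃ t, N ≤ t ∧ T.j (t + 1) = k) :
    ∃ N, ∀ t, N ≤ t → ∀ k, OffHeavy q k (T.st (t + 1)).F := by
  obtain ⟨N₀, h₀⟩ := T.eventually_offHeavy_of_recurs T₀ hc 0 (hall 0)
  obtain ⟨N₁, h₁⟩ := T.eventually_offHeavy_of_recurs T₀ hc 1 (hall 1)
  obtain ⟨N₂, h₂⟩ := T.eventually_offHeavy_of_recurs T₀ hc 2 (hall 2)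
  refine ⟨N₀ + N₁ + N₂, fun t ht k => ?_⟩
  fin_cases k
  · exact h₀ t (by omega)
  · exact h₁ t (by omega)
  · exact h₂ t (by omega)

omit [DecidableEq K] in
/-- the top ideal of an everywhere-axial stage lies in ALL THREE axis ideals (the three top lines meet at the point).
[folklore] -/
theorem topIdeal_le_tripod {F : MvPolynomial (Fin 3) K} (h : ∀ k, OffHeavy q k F) :
    topIdeal q F ≤ ⨅ k : Fin 3, Ideal.span (MvPolynomial.X '' {i : Fin 3 | i ≠ k}) :=
  le_iInf fun k => topIdeal_le_axis_of_offHeavy (h k)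

/-- A corner thread — ANY word — is EVENTUALLY NON-ISOLATED (the model shadow of lens-6's NonIso kind for ALL corner
threads). [DECIDED — PROVED here] (Sources: Hauser2010, §F.) -/
theorem Thread.eventually_not_isolated_of_cornerTail (T : Thread q s₀) (T₀ : ℕ) (hc : T.CornerTailFrom T₀) :
    ∃ N, ∀ t, N ≤ t → ¬ IsolatedTop q (T.st (t + 1)).F := by
  obtain ⟨N, hN⟩ := T.eventually_offHeavy_of_cornerTail T₀ hc
  exact ⟨N, fun t ht => not_isolatedTop_of_offHeavy (hN t ht)⟩

/-- CONTRAPOSITIVE: a thread whose top point is isolated infinitely often is NOT a corner tail, i.e. it is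
TRANSLATING (the Iso side contains no corner thread of the model at all). [DECIDED — PROVED here] (Sources: Hauser2010, §F.) -/
theorem Thread.translating_of_isolated_io (T : Thread q s₀)
    (hiso : ∀ N, ∃ t, N ≤ t ∧ IsolatedTop q (T.st (t + 1)).F) : T.Translating := by
  rcases T.translating_or_cornerTail with h | ⟨T₀, hc⟩
  · exact h
  · obtain ⟨N, hN⟩ := T.eventually_not_isolated_of_cornerTail T₀ hc
    obtain ⟨t, ht, hi⟩ := hiso N
    exact (hN t ht hi).elim

end AllCharts

section Walks

variable {K : Type} [Field K] [DecidableEq K] {q : ℕ} {s₀ : State (Fin 3) K}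

/-! ## §4 FORCED WALKS: every corner cell at once (the tree's cells as corollaries, all binders idle) -/

/-- **NO FORCED WALK HAS A CORNER TAIL** — every `q`, every field, no root / `CharP` / perfectness hypothesis: the thread
law + the walk's isolation witness at ONE late stage. [DECIDED — PROVED here] (Sources: Hauser2010, §F.) -/
theorem _root_.Summit.ResolutionOfSingularities.ResolutionOfSingularities.Theorems.TightDefectClasses.ForcedWalk.no_cornerTail
    (W : ForcedWalk q s₀) (T₀ : ℕ) (hc : ∀ t, T₀ ≤ t → W.b (t + 1) = 0) : False := by
  obtain ⟨N, hN⟩ := W.toThread.eventually_offHeavy_of_cornerTail T₀ hc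
  exact not_isolatedTop_of_offHeavy (hN N le_rfl) (W.isolated (N + 1))

/-- **EVERY FORCED WALK IS TRANSLATING** (translations `b ≠ 0` infinitely often) — the whole corner column of lens-5's
walk classification is EMPTY; what remains of `DefectWalksTerminateDeep` is the translating column ((T-tr) of the
window). [DECIDED — PROVED here] (Sources: Hauser2010, §F.) -/
theorem _root_.Summit.ResolutionOfSingularities.ResolutionOfSingularities.Theorems.TightDefectClasses.ForcedWalk.translating
    (W : ForcedWalk q s₀) : W.toThread.Translating := by
  rcases W.toThread.translating_or_cornerTail with h | ⟨T₀, hT₀⟩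
  · exact h
  · exact (W.no_cornerTail T₀ hT₀).elim

/-- RECOVERY (lens-3 g12's piece, by name): `ProximityCut.NoOriginTails` follows from the thread law with ALL its binders
(`p` prime, `e ≥ 1`, `CharP`, `PerfectField`, `IsRoot`) IDLE. [folklore] -/
theorem noOriginTails_of_heron : ProximityCut.NoOriginTails :=
  fun _ _ _ _ _ _ _ _ _ _ _ W N hN => W.no_cornerTail N fun t ht => hN (t + 1) (Nat.le_succ_of_le ht)

/-- RECOVERY (tree cell `LassoCut.corner_tail_uses_all_charts`, upgraded): its hypothesis «a forced walk with a corner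
tail» is now ABSURD, so every conclusion follows — in particular the tree's «every chart recurs». [folklore] -/
theorem _root_.Summit.ResolutionOfSingularities.ResolutionOfSingularities.Theorems.TightDefectClasses.ForcedWalk.cornerTail_elim
    (W : ForcedWalk q s₀) (T₀ : ℕ) (hrec : ∀ t, T₀ ≤ t → W.b (t + 1) = 0) (P : Prop) : P :=
  (W.no_cornerTail T₀ hrec).elim

/-- … instance: the tree's statement, recovered with a one-line proof. [folklore] -/
theorem corner_tail_uses_all_charts' (W : ForcedWalk q s₀) (T₀ : ℕ) (hrec : ∀ t, T₀ ≤ t → W.b (t + 1) = 0)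
    (l : Fin 3) (T : ℕ) : ∃ t, T ≤ t ∧ W.j (t + 1) = l :=
  W.cornerTail_elim T₀ hrec _

end Walks

end Summit.ResolutionOfSingularities.ResolutionOfSingularities.Theorems.ThreadCut
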